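import Literature.AlgebraicGeometry.Resolution.AlterationsCurves
import Literature.AlgebraicGeometry.Resolution.AlterationsDescentLimit3
import Literature.AlgebraicGeometry.Resolution.RelativeDimensionCurve
import Literature.AlgebraicGeometry.Motives.AbelianVarietyIsogenyProofs
import HarnessLib

/-!
# De Jong's alteration theorem for curves over an arbitrary field (de Jong 1996, 4.3 with 4.5)

Topic: `Literature/AlgebraicGeometry/Resolution`. Companion to `AlterationsCurves.lean`, which
proves de Jong 1996, Thm. 4.1 with its generically-étale clause for curves over ALGEBRAICALLY
CLOSED fields (`DeJong1996.statementUpToDim_one`, loc. cit. 4.3). The printed reduction 4.5 to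
an algebraically closed ground field,

> "4.5. Let `k̄` be an algebraic closure of `k`. Let `X̄'` be an irreducible component of the
> scheme `X ×_{Spec k} Spec k̄`, and let `Z̄'` be the inverse image of `Z` in `X̄'`. Suppose we
> can find `φ̄₁ : X̄₁ → X̄'` and `j̄₁ : X̄₁ → X̄̄₁` over `k̄` as in the theorem. There exists a
> finite extension `k₁` of `k` contained in `k̄` such that `X̄', X̄₁, X̄̄₁, φ̄₁` and `j̄₁` exist
> over `k₁`. […] If we put `φ₁ : X₁ → X` equal to the composition of `φ₁'` with the natural
> morphism `X' ↪ X ⊗ k₁ → X` then the quadruple `(X₁, X̄₁, φ₁, j₁)` is a solution to the problem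
> posed in the theorem. (Note that if `φ̄₁` is generically étale then so is `φ₁'`, and if `k`
> is perfect, then `X' → X` will be generically étale too.)",

is PROVED in the tree (`AlterationsDescent.lean`, with the limit argument
`DeJong1996.FiniteSubextension45_holds` of `AlterationsDescentLimit3.lean`), but vendored as the
global implication `DeJong1996Descent : DeJong1996StrongAlgClosed → DeJong1996Strong ∧ …`, which
consumes Thm. 4.1 over `k̄` in ALL dimensions. The argument is dimensionwise: `X̄'` is an
irreducible component of `X ⊗_k k̄`, and `dim X̄' ≤ dim (X ⊗_k k̄) ≤ dim X` because
`X ⊗_k k̄ → X` is integral (base change of `Spec k̄ → Spec k`), hence has incomparable fibres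
(Stacks 00GT, 0ECG; `eq_of_specializes_of_isIntegralHom`,
`Literature.AlgebraicGeometry.Motives.topologicalKrullDim_le_of_specializes_imp_eq`). This
file records that refinement and combines it with the curve case:

* `DeJong1996.exists_conclusionGenericallyEtale_over_finite_of_statementUpToDim` — 4.5, first
  half, from Thm. 4.1 over `k̄` in dimension `≤ d` only (`DeJong1996.StatementUpToDim k̄ d`) for
  a pair `(X, Z)` with `dim X ≤ d`;
  `DeJong1996.conclusion_of_statementUpToDim_algebraicClosure`,
  `DeJong1996.conclusionGenericallyEtale_of_statementUpToDim_algebraicClosure` (perfect `k`) —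
  4.5 assembled dimensionwise.
* `DeJong1996.conclusion_of_dim_le_one` — **Thm. 4.1 (i)+(ii) for every variety of dimension
  `≤ 1` over every field**, PROVED; `DeJong1996.conclusionGenericallyEtale_of_dim_le_one_of_perfectField`
  — with the generically-étale clause over perfect fields, PROVED. These are the cases
  `dim X ≤ 1` of the named facts `DeJong1996Strong` and `DeJong1996StrongPerfect`.
* `deJong1996Projective_of_dim_le_one` — the case `dim X ≤ 1` of the named fact
  `DeJong1996Projective` (`AlterationsProofs.lean`: Thm. 4.1 (i), a regular projective
  compactification of an alteration), PROVED.
* `DeJong1996NormalProjectiveStep.of_one_le` and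
  `DeJong1996Projective.of_normalProjectiveStep_one_le` (with `…StrongAlgClosed…`, `…Strong…`,
  `…StrongPerfect…`) — the induction re-assembled with BOTH printed base cases of 4.3
  (`dim X = 0` and `dim X = 1`) proved and 4.4, 4.5 (`DeJong1996Descent_holds`), 4.6–4.10
  (`DeJong1996NormalProjectiveReduction_holds`) discharged: the named facts
  `DeJong1996Projective`, `DeJong1996Strong`, `DeJong1996StrongPerfect` follow from the
  instances `d ≥ 1` (`dim X ≥ 2`) of `DeJong1996NormalProjectiveStep` (4.11–4.28) alone.

## Sources

* A. J. de Jong, *Smoothness, semi-stability and alterations*, Publ. Math. IHÉS 83 (1996)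
  51–93: Thm. 4.1, 4.3, 4.5 (p. 66).
* The Stacks Project, Tags 00GT (incomparability for integral ring maps), 0ECG (integral
  morphisms preserve dimensions of closed subsets).
-/

noncomputable section

open CategoryTheory CategoryTheory.Limits AlgebraicGeometry TopologicalSpace Topology

namespace Literature.AlgebraicGeometry.Resolution

universe u

namespace DeJong1996

open Scheme.IdealSheafData

variable {k : Type u} [Field k]

/-! ## 4.5 dimensionwise -/

/-- The base change `X ⊗_k K → X` of a `k`-scheme along an algebraic field extension `K/k` does
not raise the dimension of closed subschemes: for a closed immersion `ι : X' → X ⊗_k K`,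
`dim X' ≤ dim X` (`X ⊗_k K → X` is integral, so it identifies no point with a proper
specialisation of it; Stacks 00GT, 0ECG). [cite: StacksProject, Tag 0ECG (Lemma 29.45.9)] -/
theorem topologicalKrullDim_le_of_isClosedImmersion_pullback (K : Type u) [Field K]
    [Algebra k K] [Algebra.IsAlgebraic k K] {X : Scheme.{u}} (f : X ⟶ Spec (.of k))
    {X' : Scheme.{u}} (ι : X' ⟶ pullback f (Spec.map (CommRingCat.ofHom (algebraMap k K))))
    [IsClosedImmersion ι] : topologicalKrullDim X' ≤ topologicalKrullDim X := by
  -- `Spec K → Spec k` is integral for `K/k` algebraic, hence so is its base change `X ⊗_k K → X`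
  haveI : IsIntegralHom (Spec.map (CommRingCat.ofHom (algebraMap k K))) := by
    refine IsIntegralHom.SpecMap_iff.mpr ?_
    change (algebraMap k K).IsIntegral
    exact fun x => Algebra.IsIntegral.isIntegral x
  haveI : IsIntegralHom (pullback.fst f (Spec.map (CommRingCat.ofHom (algebraMap k K)))) :=
    inferInstance
  calc topologicalKrullDim X'
      ≤ topologicalKrullDim ↥(pullback f (Spec.map (CommRingCat.ofHom (algebraMap k K)))) :=
        ι.isClosedEmbedding.topologicalKrullDim_le
    _ ≤ topologicalKrullDim X :=
        Literature.AlgebraicGeometry.Motives.topologicalKrullDim_le_of_specializes_imp_eq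
          (pullback.fst f (Spec.map (CommRingCat.ofHom (algebraMap k K)))).continuous
          fun _ _ hab hpab => eq_of_specializes_of_isIntegralHom _ hab hpab

/-- **de Jong 1996, 4.5, first half, dimensionwise**: "Let `k̄` be an algebraic closure of `k`.
Let `X̄'` be an irreducible component of the scheme `X ×_{Spec k} Spec k̄`, and let `Z̄'` be the
inverse image of `Z` in `X̄'`" — `X̄'` is a variety over `k̄` of dimension `≤ dim X`
(`topologicalKrullDim_le_of_isClosedImmersion_pullback`) and `Z̄'` a proper closed subset, so
Thm. 4.1 with its generically-étale clause over `k̄` IN DIMENSION `≤ d`, `dim X ≤ d`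
(`StatementUpToDim k̄ d`), applies to `(X̄', Z̄')`, and the limit argument
(`FiniteSubextension45_holds`) descends its conclusion to an irreducible component `X'` of
`X ⊗_k k₁` for a finite subextension `k ⊆ k₁ ⊆ k̄`. (The tree's
`exists_conclusionGenericallyEtale_over_finite` is the same statement fed with Thm. 4.1 over `k̄`
in all dimensions.) [cite: DeJong1996, 4.5, p. 66] -/
theorem exists_conclusionGenericallyEtale_over_finite_of_statementUpToDim {d : ℕ}
    (hd : StatementUpToDim (AlgebraicClosure k) d) (X : Scheme.{u}) (f : X ⟶ Spec (.of k))
    [IsIntegral X] [IsSeparated f] [LocallyOfFiniteType f] [QuasiCompact f]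
    (hdim : topologicalKrullDim X ≤ d) {Z : Set X} (hZ : IsClosed Z) (hZ' : Z ≠ Set.univ) :
    ∃ (k₁ : IntermediateField k (AlgebraicClosure k)) (_ : FiniteDimensional k k₁)
      (X' : Scheme.{u})
      (ι' : X' ⟶ pullback f (Spec.map (CommRingCat.ofHom (algebraMap k k₁)))),
      IsIntegral X' ∧ IsClosedImmersion ι' ∧
      Set.range ι' ∈ irreducibleComponents
        (↑(pullback f (Spec.map (CommRingCat.ofHom (algebraMap k k₁)))) : Type u) ∧
      ConclusionGenericallyEtale
        (ι' ≫ pullback.snd f (Spec.map (CommRingCat.ofHom (algebraMap k k₁))))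
        ((ι' ≫ pullback.fst f (Spec.map (CommRingCat.ofHom (algebraMap k k₁)))) ⁻¹' Z) := by
  let K := AlgebraicClosure k
  set s := Spec.map (CommRingCat.ofHom (algebraMap k K)) with hs
  set Y := pullback f s
  -- `Y = X ⊗_k k̄` is non-empty; choose an irreducible component `C`
  haveI : Nonempty Y := by
    obtain ⟨y, -⟩ := (pullback.fst f s).surjective (genericPoint X)
    exact ⟨y⟩
  let y₀ : Y := Classical.arbitrary Y
  let C : Set Y := irreducibleComponent y₀
  have hC : C ∈ irreducibleComponents (Y : Type u) :=
    irreducibleComponent_mem_irreducibleComponents y₀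
  let Cc : Closeds Y := ⟨C, isClosed_irreducibleComponent⟩
  let Xb : Scheme.{u} := (vanishingIdeal Cc).subscheme
  let ιb : Xb ⟶ Y := (vanishingIdeal Cc).subschemeι
  haveI : IsIntegral Xb := isIntegral_subscheme_vanishingIdeal Cc hC.1
  have hrange : Set.range ιb = C := range_subschemeι_vanishingIdeal Cc
  have hCb : Set.range ιb ∈ irreducibleComponents (Y : Type u) := hrange ▸ hC
  -- `Z̄'` is a proper closed subset of `X̄'`
  have hZb : IsClosed ((ιb ≫ pullback.fst f s) ⁻¹' Z) :=
    hZ.preimage (ιb ≫ pullback.fst f s).continuous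
  have hZb' : (ιb ≫ pullback.fst f s) ⁻¹' Z ≠ Set.univ := by
    intro h
    have hη : genericPoint Xb ∈ (ιb ≫ pullback.fst f s) ⁻¹' Z := h ▸ Set.mem_univ _
    rw [Set.mem_preimage, comp_apply_genericPoint_eq (pullback.fst f s) ιb hCb] at hη
    exact genericPoint_notMem_of_isClosed hZ hZ' hη
  -- `dim X̄' ≤ dim X ≤ d`
  have hdimb : topologicalKrullDim Xb ≤ d :=
    (topologicalKrullDim_le_of_isClosedImmersion_pullback K f ιb).trans hdim
  -- Thm. 4.1 over `k̄` in dimension `≤ d`, then the limit argument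
  have h := hd Xb (ιb ≫ pullback.snd f s) ((ιb ≫ pullback.fst f s) ⁻¹' Z) inferInstance
    inferInstance inferInstance inferInstance hdimb hZb hZb'
  exact FiniteSubextension45_holds k K X f Z hZ hZ' Xb ιb hCb h

/-- **de Jong 1996, 4.5 dimensionwise**: Thm. 4.1 with its generically-étale clause over `k̄` in
dimension `≤ d` gives Thm. 4.1 (i)+(ii) over `k` for every pair `(X, Z)` with `dim X ≤ d`
("the quadruple `(X₁, X̄₁, φ₁, j₁)` is a solution to the problem posed in the theorem":
`X' → X` is an alteration, `isAlteration_comp_fst`; projectivity restricts along `k ⊆ k₁`,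
`ConclusionGenericallyEtale.restrictScalars`; alterations compose, 4.4).
[cite: DeJong1996, 4.5, p. 66] -/
theorem conclusion_of_statementUpToDim_algebraicClosure {d : ℕ}
    (hd : StatementUpToDim (AlgebraicClosure k) d) (X : Scheme.{u}) (f : X ⟶ Spec (.of k))
    [IsIntegral X] [IsSeparated f] [LocallyOfFiniteType f] [QuasiCompact f]
    (hdim : topologicalKrullDim X ≤ d) {Z : Set X} (hZ : IsClosed Z) (hZ' : Z ≠ Set.univ) :
    Conclusion f Z := by
  obtain ⟨k₁, hfin, X', ι', hi', hc', hC, h⟩ :=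
    exists_conclusionGenericallyEtale_over_finite_of_statementUpToDim hd X f hdim hZ hZ'
  haveI := hfin
  have hφ := isAlteration_comp_fst (k₁ := k₁) f ι' hC
  have h' := (ConclusionGenericallyEtale.restrictScalars (k := k) h).conclusion
  rw [Category.assoc, ← pullback.condition, ← Category.assoc] at h'
  exact Conclusion.of_isAlteration hφ h'

/-- **de Jong 1996, 4.5 dimensionwise, perfect ground field**: with `k` perfect the alteration
`X' ↪ X ⊗ k₁ → X` is generically étale too (`isGenericallyEtale_comp_fst`), so the
generically-étale clause descends as well. [cite: DeJong1996, 4.5, p. 66] -/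
theorem conclusionGenericallyEtale_of_statementUpToDim_algebraicClosure [PerfectField k] {d : ℕ}
    (hd : StatementUpToDim (AlgebraicClosure k) d) (X : Scheme.{u}) (f : X ⟶ Spec (.of k))
    [IsIntegral X] [IsSeparated f] [LocallyOfFiniteType f] [QuasiCompact f]
    (hdim : topologicalKrullDim X ≤ d) {Z : Set X} (hZ : IsClosed Z) (hZ' : Z ≠ Set.univ) :
    ConclusionGenericallyEtale f Z := by
  obtain ⟨k₁, hfin, X', ι', hi', hc', hC, h⟩ :=
    exists_conclusionGenericallyEtale_over_finite_of_statementUpToDim hd X f hdim hZ hZ'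
  haveI := hfin
  have hφ := isAlteration_comp_fst (k₁ := k₁) f ι' hC
  have hφe := isGenericallyEtale_comp_fst (k₁ := k₁) f ι' hC
  have h' := ConclusionGenericallyEtale.restrictScalars (k := k) h
  rw [Category.assoc, ← pullback.condition, ← Category.assoc] at h'
  exact ConclusionGenericallyEtale.of_isAlteration hφ hφe h'

/-! ## Theorem 4.1 for curves over every field -/

/-- **De Jong's alteration theorem for curves, over every field** (de Jong 1996, Thm. 4.1
(i)+(ii) for `dim X ≤ 1`; loc. cit. 4.3 "so is the case `dim X = 1`, as we see by taking `X₁`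
to be the normalization of `X`" together with 4.5): for a variety `X` of dimension `≤ 1` over
a field `k` and a proper closed subset `Z ⊂ X` there are an alteration `φ₁ : X₁ → X` and an
open immersion `j₁ : X₁ → X̄₁` over `k` with `X̄₁` a regular projective variety and
`j₁(φ₁⁻¹(Z)) ∪ X̄₁ ∖ j₁(X₁)` a strict normal crossings divisor. PROVED (curve case over `k̄`,
`statementUpToDim_one`, and 4.5 dimensionwise). [cite: DeJong1996, Thm. 4.1 and 4.3, p. 66] -/
theorem conclusion_of_dim_le_one (X : Scheme.{u}) (f : X ⟶ Spec (.of k)) [IsIntegral X]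
    [IsSeparated f] [LocallyOfFiniteType f] [QuasiCompact f] (hdim : topologicalKrullDim X ≤ 1)
    {Z : Set X} (hZ : IsClosed Z) (hZ' : Z ≠ Set.univ) : Conclusion f Z :=
  conclusion_of_statementUpToDim_algebraicClosure (statementUpToDim_one (AlgebraicClosure k))
    X f (by exact_mod_cast hdim) hZ hZ'

/-- **De Jong's alteration theorem for curves over a perfect field, with the generically-étale
clause** (de Jong 1996, Thm. 4.1 with its last sentence, for `dim X ≤ 1`). PROVED.
[cite: DeJong1996, Thm. 4.1 and 4.3, p. 66] -/
theorem conclusionGenericallyEtale_of_dim_le_one_of_perfectField [PerfectField k]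
    (X : Scheme.{u}) (f : X ⟶ Spec (.of k)) [IsIntegral X] [IsSeparated f]
    [LocallyOfFiniteType f] [QuasiCompact f] (hdim : topologicalKrullDim X ≤ 1) {Z : Set X}
    (hZ : IsClosed Z) (hZ' : Z ≠ Set.univ) : ConclusionGenericallyEtale f Z :=
  conclusionGenericallyEtale_of_statementUpToDim_algebraicClosure
    (statementUpToDim_one (AlgebraicClosure k)) X f (by exact_mod_cast hdim) hZ hZ'

end DeJong1996

/-! ## The named fact `DeJong1996Projective` in dimension `≤ 1`

(`DeJong1996.conclusion_of_dim_le_one` and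
`DeJong1996.conclusionGenericallyEtale_of_dim_le_one_of_perfectField` above are verbatim the
cases `dim X ≤ 1` of `DeJong1996Strong` and `DeJong1996StrongPerfect`.) -/

/-- **The case `dim X ≤ 1` of `DeJong1996Projective`** (de Jong 1996, Thm. 4.1 (i): a variety of
dimension `≤ 1` over any field `k` admits an alteration `φ₁ : X₁ → X` which is an open subscheme
`j₁ : X₁ → X̄₁`, over `k`, of a regular projective variety `X̄₁`), PROVED — the instance
`Z = ∅` of `DeJong1996.conclusion_of_dim_le_one`, forgetting the boundary divisor.
[cite: DeJong1996, Thm. 4.1 (i) and 4.3, p. 66] -/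
theorem deJong1996Projective_of_dim_le_one (k : Type u) [Field k] (X : Scheme.{u})
    (f : X ⟶ Spec (.of k)) [IsSeparated f] [LocallyOfFiniteType f] [QuasiCompact f]
    [IsIntegral X] (hdim : topologicalKrullDim X ≤ 1) :
    ∃ (X₁ Xbar₁ : Scheme.{u}) (φ₁ : X₁ ⟶ X) (j₁ : X₁ ⟶ Xbar₁) (g : Xbar₁ ⟶ Spec (.of k)),
      IsAlteration φ₁ ∧ IsOpenImmersion j₁ ∧ IsIntegral Xbar₁ ∧
        Literature.AlgebraicGeometry.Motives.IsProjectiveOver (Over.mk g) ∧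
          Scheme.IsRegular Xbar₁ ∧ j₁ ≫ g = φ₁ ≫ f := by
  obtain ⟨X₁, Xbar₁, φ₁, j₁, g, h₁, h₂, h₃, h₄, h₅, h₆, -⟩ :=
    DeJong1996.conclusion_of_dim_le_one X f hdim (Z := ∅) isClosed_empty
      (Set.empty_ne_univ)
  exact ⟨X₁, Xbar₁, φ₁, j₁, g, h₁, h₂, h₃, h₄, h₅, h₆⟩

/-! ## The induction with the curve case as base: the step facts are only needed for `dim X ≥ 2` -/

/-- **`DeJong1996NormalProjectiveStep` from its instances `d ≥ 1` (`dim X ≥ 2`)**, the instance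
`d = 0` (normal projective curves) being PROVED (`DeJong1996.normalProjectiveStep_zero`, de Jong
1996, 4.3). The printed 4.11–4.28 (`f : X' → ℙ^{d-1}`, …) address `dim X ≥ 2`; this is the
form in which a discharge of those steps closes the named fact. [cite: DeJong1996, 4.3, p. 66] -/
theorem DeJong1996NormalProjectiveStep.of_one_le
    (hstep : ∀ (k : Type u) [Field k] [IsAlgClosed k] (d : ℕ), 1 ≤ d →
      DeJong1996.StatementUpToDim k d →
        ∀ (X : Scheme.{u}) (f : X ⟶ Spec (.of k)) (Z : Set X),
          DeJong1996.NormalProjectivePair f Z → topologicalKrullDim X = (d + 1 : ℕ) →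
            DeJong1996.ConclusionGenericallyEtale f Z) :
    DeJong1996NormalProjectiveStep.{u} := by
  intro k _ _ d ih X f Z hP hdim
  rcases Nat.eq_zero_or_pos d with rfl | hd
  · exact DeJong1996.normalProjectiveStep_zero k ih X f Z hP hdim
  · exact hstep k d hd ih X f Z hP hdim

/-- **Thm. 4.1 with its generically-étale clause over algebraically closed fields from the step
for normal projective pairs of dimension `≥ 2` alone** — 4.3 (both base cases), 4.4 and
4.6–4.10 being proved (`DeJong1996StrongAlgClosed.of_step`,
`DeJong1996NormalProjectiveReduction_holds`). [cite: DeJong1996, 4.3–4.10, pp. 66–67] -/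
theorem DeJong1996StrongAlgClosed.of_normalProjectiveStep_one_le
    (hstep : ∀ (k : Type u) [Field k] [IsAlgClosed k] (d : ℕ), 1 ≤ d →
      DeJong1996.StatementUpToDim k d →
        ∀ (X : Scheme.{u}) (f : X ⟶ Spec (.of k)) (Z : Set X),
          DeJong1996.NormalProjectivePair f Z → topologicalKrullDim X = (d + 1 : ℕ) →
            DeJong1996.ConclusionGenericallyEtale f Z) :
    DeJong1996StrongAlgClosed.{u} :=
  DeJong1996StrongAlgClosed.of_step (DeJong1996NormalProjectiveStep.of_one_le hstep)

/-- **Thm. 4.1 (i)+(ii) over every field from the step for normal projective pairs of dimension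
`≥ 2` over algebraically closed fields alone** — 4.3, 4.4, 4.5 (`DeJong1996Descent_holds`) and
4.6–4.10 being proved. [cite: DeJong1996, 4.3–4.10, pp. 66–67] -/
theorem DeJong1996Strong.of_normalProjectiveStep_one_le
    (hstep : ∀ (k : Type u) [Field k] [IsAlgClosed k] (d : ℕ), 1 ≤ d →
      DeJong1996.StatementUpToDim k d →
        ∀ (X : Scheme.{u}) (f : X ⟶ Spec (.of k)) (Z : Set X),
          DeJong1996.NormalProjectivePair f Z → topologicalKrullDim X = (d + 1 : ℕ) →
            DeJong1996.ConclusionGenericallyEtale f Z) :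
    DeJong1996Strong.{u} :=
  DeJong1996Strong.of_descent_of_step DeJong1996Descent_holds
    (DeJong1996NormalProjectiveStep.of_one_le hstep)

/-- The last sentence of Thm. 4.1 (perfect fields) from the same single input.
[cite: DeJong1996, 4.3–4.10, pp. 66–67] -/
theorem DeJong1996StrongPerfect.of_normalProjectiveStep_one_le
    (hstep : ∀ (k : Type u) [Field k] [IsAlgClosed k] (d : ℕ), 1 ≤ d →
      DeJong1996.StatementUpToDim k d →
        ∀ (X : Scheme.{u}) (f : X ⟶ Spec (.of k)) (Z : Set X),
          DeJong1996.NormalProjectivePair f Z → topologicalKrullDim X = (d + 1 : ℕ) →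
            DeJong1996.ConclusionGenericallyEtale f Z) :
    DeJong1996StrongPerfect.{u} :=
  DeJong1996StrongPerfect.of_descent_of_step DeJong1996Descent_holds
    (DeJong1996NormalProjectiveStep.of_one_le hstep)

/-- **`DeJong1996Projective` (Thm. 4.1 (i)) from the step for normal projective pairs of
dimension `≥ 2` over algebraically closed fields alone**: after `AlterationsCurves.lean` (4.3,
`dim X ≤ 1`), `AlterationsReductionHolds.lean` (4.6–4.10) and `AlterationsDescentLimit3.lean`
(4.5), the instances `d ≥ 1` of `DeJong1996NormalProjectiveStep` (de Jong 1996, 4.11–4.28 in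
dimension `≥ 2`) are the only unproved input of the named fact. [cite: DeJong1996, Thm. 4.1, p. 66] -/
theorem DeJong1996Projective.of_normalProjectiveStep_one_le
    (hstep : ∀ (k : Type u) [Field k] [IsAlgClosed k] (d : ℕ), 1 ≤ d →
      DeJong1996.StatementUpToDim k d →
        ∀ (X : Scheme.{u}) (f : X ⟶ Spec (.of k)) (Z : Set X),
          DeJong1996.NormalProjectivePair f Z → topologicalKrullDim X = (d + 1 : ℕ) →
            DeJong1996.ConclusionGenericallyEtale f Z) :
    DeJong1996Projective.{u} :=
  (DeJong1996Strong.of_normalProjectiveStep_one_le hstep).projective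

/-- The same re-assembly through the cut at 4.12 (`AlterationsFibrations.lean`):
`DeJong1996NormalProjectiveStep` from Lemma 4.11–4.12 for normal projective pairs of dimension
`≥ 2` (the body of `DeJong1996FibrationReduction` under `2 ≤ dim X`, where the printed
`f : X' → ℙ^{d-1}` lives) and 4.13–4.28 for pairs in situation (vi) of dimension `≥ 2` (the
instances `d ≥ 1` of `DeJong1996NormalProjectiveStepVI`), the curve case being proved.
[cite: DeJong1996, 4.3 and 4.11–4.12, pp. 66–69] -/
theorem DeJong1996NormalProjectiveStep.of_fibration_of_stepVI_one_le
    (h₁ : ∀ (k : Type u) [Field k] [IsAlgClosed k] (X : Scheme.{u}) (fX : X ⟶ Spec (.of k))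
      (Z : Set X), DeJong1996.NormalProjectivePair fX Z → 2 ≤ topologicalKrullDim X →
        ∃ (X' : Scheme.{u}) (φ : X' ⟶ X), IsAlteration φ ∧ IsGenericallyEtale φ ∧
          DeJong1996.SituationVI (φ ≫ fX) (φ ⁻¹' Z))
    (h₂ : ∀ (k : Type u) [Field k] [IsAlgClosed k] (d : ℕ), 1 ≤ d →
      DeJong1996.StatementUpToDim k d →
        ∀ (X : Scheme.{u}) (fX : X ⟶ Spec (.of k)) (Z : Set X), DeJong1996.SituationVI fX Z →
          topologicalKrullDim X = (d + 1 : ℕ) → DeJong1996.ConclusionGenericallyEtale fX Z) :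
    DeJong1996NormalProjectiveStep.{u} := by
  refine DeJong1996NormalProjectiveStep.of_one_le fun k _ _ d hd ih X f Z hP hdim => ?_
  haveI := hP.isIntegral
  haveI := hP.isProper
  have h2 : (2 : WithBot ℕ∞) ≤ topologicalKrullDim X := by
    rw [hdim]
    exact_mod_cast Nat.succ_le_succ hd
  obtain ⟨X', φ, hφ, hφe, hVI⟩ := h₁ k X f Z hP h2
  refine DeJong1996.ConclusionGenericallyEtale.of_isAlteration hφ hφe ?_
  exact h₂ k d hd ih X' (φ ≫ f) (φ ⁻¹' Z) hVI (by rw [hφ.topologicalKrullDim_eq f, hdim])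

end Literature.AlgebraicGeometry.Resolution

end
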